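import Literature.NumberTheory.LFunctions.WeilTwoPrimeDeflM72YBase
import Literature.NumberTheory.LFunctions.WeilBlockRowsFast
import HarnessLib

/-!
# Deflated two-prime certificate M72Y: the odd Bessel block claim `Hp = C H Cᵀ`, rows 30–34 (fast linear-traversal check)

The rows are checked with `WeilCert.checkHpRowT` (linear traversals, triangular storage of `weilCert23HC`) instead of the
indexed `checkHpRow` decide.  Pure proof file.
-/

noncomputable section

namespace Literature.NumberTheory.LFunctions

set_option maxHeartbeats 0 in
/-- Fast kernel check of claim row 30 of `Hp = C H Cᵀ` (odd block, certificate M72Y; triangular `C`). [folklore] -/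
theorem checkHpRowT1_30_weilCertDeflM72Y : weilCertDeflM72YBase.checkHpRowT weilCertDeflM72YHpO 1 30 = true := by
  decide +kernel

/-- Claim row 30 of `Hp = C H Cᵀ` (odd block, certificate M72Y), from the fast check. [folklore] -/
theorem checkHpRow1_30_weilCertDeflM72Y : weilCertDeflM72YBase.checkHpRow weilCertDeflM72YHpO 1 30 = true :=
  WeilCert.checkHpRow_of_T checkHpRowT1_30_weilCertDeflM72Y

set_option maxHeartbeats 0 in
/-- Fast kernel check of claim row 31 of `Hp = C H Cᵀ` (odd block, certificate M72Y; triangular `C`). [folklore] -/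
theorem checkHpRowT1_31_weilCertDeflM72Y : weilCertDeflM72YBase.checkHpRowT weilCertDeflM72YHpO 1 31 = true := by
  decide +kernel

/-- Claim row 31 of `Hp = C H Cᵀ` (odd block, certificate M72Y), from the fast check. [folklore] -/
theorem checkHpRow1_31_weilCertDeflM72Y : weilCertDeflM72YBase.checkHpRow weilCertDeflM72YHpO 1 31 = true :=
  WeilCert.checkHpRow_of_T checkHpRowT1_31_weilCertDeflM72Y

set_option maxHeartbeats 0 in
/-- Fast kernel check of claim row 32 of `Hp = C H Cᵀ` (odd block, certificate M72Y; triangular `C`). [folklore] -/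
theorem checkHpRowT1_32_weilCertDeflM72Y : weilCertDeflM72YBase.checkHpRowT weilCertDeflM72YHpO 1 32 = true := by
  decide +kernel

/-- Claim row 32 of `Hp = C H Cᵀ` (odd block, certificate M72Y), from the fast check. [folklore] -/
theorem checkHpRow1_32_weilCertDeflM72Y : weilCertDeflM72YBase.checkHpRow weilCertDeflM72YHpO 1 32 = true :=
  WeilCert.checkHpRow_of_T checkHpRowT1_32_weilCertDeflM72Y

set_option maxHeartbeats 0 in
/-- Fast kernel check of claim row 33 of `Hp = C H Cᵀ` (odd block, certificate M72Y; triangular `C`). [folklore] -/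
theorem checkHpRowT1_33_weilCertDeflM72Y : weilCertDeflM72YBase.checkHpRowT weilCertDeflM72YHpO 1 33 = true := by
  decide +kernel

/-- Claim row 33 of `Hp = C H Cᵀ` (odd block, certificate M72Y), from the fast check. [folklore] -/
theorem checkHpRow1_33_weilCertDeflM72Y : weilCertDeflM72YBase.checkHpRow weilCertDeflM72YHpO 1 33 = true :=
  WeilCert.checkHpRow_of_T checkHpRowT1_33_weilCertDeflM72Y

set_option maxHeartbeats 0 in
/-- Fast kernel check of claim row 34 of `Hp = C H Cᵀ` (odd block, certificate M72Y; triangular `C`). [folklore] -/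
theorem checkHpRowT1_34_weilCertDeflM72Y : weilCertDeflM72YBase.checkHpRowT weilCertDeflM72YHpO 1 34 = true := by
  decide +kernel

/-- Claim row 34 of `Hp = C H Cᵀ` (odd block, certificate M72Y), from the fast check. [folklore] -/
theorem checkHpRow1_34_weilCertDeflM72Y : weilCertDeflM72YBase.checkHpRow weilCertDeflM72YHpO 1 34 = true :=
  WeilCert.checkHpRow_of_T checkHpRowT1_34_weilCertDeflM72Y

end Literature.NumberTheory.LFunctions
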